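import Summits.Langlands.Langlands.Theses.PhantomRMYoshida
import Literature.NumberTheory.Automorphic.SerreConjectureProofs
import Literature.NumberTheory.GaloisRepresentations.SerreWeightLowerBoundProofs
import Summits.Langlands.Langlands.Theorems.PhantomRMYoshidaSerreKWAutomorphicGL2ResidueAdaptedEmbedding
import Summits.Langlands.Langlands.Theorems.PhantomRMYoshidaSerreKWAutomorphicGL2ConjugateNewform
import Summits.Langlands.Langlands.Theorems.PhantomRMYoshidaSerreKWAutomorphicGL2LoweringKillsLift
import Summits.Langlands.Langlands.Theorems.PhantomRMYoshidaSerreKWAutomorphicGL2AdelicLiftIsCuspForm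
import Summits.Langlands.Langlands.Theorems.PhantomRMYoshidaSerreKWAutomorphicGL2ArchParameterOfGeneratedDatum
import Summits.Langlands.Langlands.Theorems.PhantomRMYoshidaSerreKWAutomorphicGL2DictionaryL
import HarnessLib

/-!
# `PhantomRMYoshida.SerreKWAutomorphicGL2` from Khare–Wintenberger (crux stmt-Langlands-12944;
# line `adelic-newform-datum-double-twist`, assembly)

Serre's conjecture for `GL₂/ℚ` in the summit's automorphic L-normalisation, PROVED MODULO the
in-tree named fact `Literature.NumberTheory.Automorphic.khare_wintenberger` (Khare–Wintenberger (I)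
Thm. 1.2 + 9.1 with Kisin 2009): `SerreKWAutomorphicGL2_of_khareWintenberger`. Ingredients (all
theorems of the tree): the weak form of KW with Serre's bound `2 ≤ k(σ̄)`
(`serreModularityTwoLe_of_khareWintenberger`); the residue-adapted embedding of the coefficient ring
(`stub_residueAdaptedEmbedding`); Galois-conjugate newform eigenpackets (`stub_conjugateNewform`);
the adelic lift is smooth and killed by the lowering operator (`stub_loweringKillsLift`), is a
Borel–Jacquet cusp form (`stub_adelicLiftIsCuspForm`), generates a datum of Harish-Chandra parameter
`{(w-1)/2, (1-w)/2}` (`stub_archParameterOfGeneratedDatum`), whose double twist is L-algebraic with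
Satake multiset the inverted Hecke roots (`stub_dictionaryL`); and the kernel-checked glue
(`arithFrobPolyOfSatake_one_rootsInv`, integrality transport along `θ`, three cofinite exceptional
sets). Trust base of the result: {`khare_wintenberger`}.
-/

noncomputable section

open scoped MatrixGroups Classical Polynomial
open NumberField IsDedekindDomain Filter Polynomial CongruenceSubgroup
open Literature.NumberTheory.Automorphic Literature.NumberTheory.EllipticCurves.ModularForms
  Literature.NumberTheory.GaloisRepresentations
  Literature.NumberTheory.GaloisRepresentations.ModPGaloisRep
  Literature.NumberTheory.GaloisRepresentations.IsNonarchimedeanLocalField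

namespace Summit.Langlands.Langlands.Cruxes.SerreKWAutomorphicGL2.AdelicNewformDatumDoubleTwist

set_option linter.dupNamespace false

/-! ## Khare–Wintenberger, weak form with the weight bound -/

/-- **Serre's conjecture, weak form with the weight bound, from `khare_wintenberger`** (sorry-free
re-indexing of Stub 1; this is the shape the glue consumes).  For every prime `p`, every
algebraically closed discrete field `k` of characteristic `p` and every continuous, odd, irreducible
`σ̄ : Γ_ℚ → GL₂(k)` there are a level `N ≥ 1`, a weight `w ≥ 2`, a newform `f ∈ S_w(Γ₁(N))` and
`ι_f : 𝓞_f →+* k` with `σ̄` attached to `f` along `ι_f` away from `N p`: for every prime `q ∤ N p`,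
`σ̄` is unramified at `q` and `charpoly σ̄(Frob_q) = ι_f(P_q)`, `P_q ∈ 𝓞_f[X]` mapping to the Hecke
polynomial `X² - a_q(f) X + ε_f(q) q^{w-1}` (`IsGaloisRepOfNewform1Int`).  Proof: instantiate the
strong form at a local restriction datum at `p` (`nonempty_localRestrictionAt`) and a residue
embedding (`nonempty_ringHom_residue`), take `N = N(σ̄)`, `w = k(σ̄)`, and use Serre's lower bound
`2 ≤ k(σ̄)` (`ModPGaloisRep.two_le_serreWeightLocal_holds`, Serre 1987, §2.4 Remarque).
[cite: KhareWintenberger2009, Thm. 1.2 and Thm. 9.1] [cite: Serre1987, §2.4 Remarque (2 ≤ k)] -/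
theorem serreModularityTwoLe_of_khareWintenberger
    (hKW : ∀ (p : ℕ) [Fact p.Prime] (k : Type) [Field k] [TopologicalSpace k] [DiscreteTopology k],
      khare_wintenberger p k) :
    ∀ (p : ℕ) [Fact p.Prime] (k : Type) [Field k] [CharP k p] [IsAlgClosed k]
      [TopologicalSpace k] [DiscreteTopology k] (σ : FramedGaloisRep ℚ k 2),
      σ.IsOdd → σ.toGaloisRep.IsIrreducible →
      ∃ (N : ℕ) (_ : NeZero N) (w : ℕ), 2 ≤ w ∧
        ∃ (f : CuspForm (Gamma1 N) (w : ℤ)) (ιf : coeffCharIntegers f →+* k),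
          IsNewform1 f ∧ IsGaloisRepOfNewform1Int f ιf {q | q ∣ N * p} σ := by
  intro p _ k _ _ _ _ _ σ hodd hirr
  obtain ⟨loc⟩ := nonempty_localRestrictionAt (k := k) p σ
  obtain ⟨ι⟩ := nonempty_ringHom_residue (k := k) p loc.F loc.residueFieldCard_eq
  obtain ⟨f, ιf, hf, hρ⟩ := hKW p k σ hirr hodd loc ι
  have h2 := ModPGaloisRep.two_le_serreWeightLocal_holds loc.rep ι
  exact ⟨serreLevel p σ, _, serreWeight p σ loc ι, h2, f, ιf, hf, hρ⟩

/-! ## Glue lemmas (sorry-free) -/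

/-- **The L-normalised Frobenius polynomial of the inverted roots is the polynomial itself.**  For
`ι : ℚ̄_p ≃+* ℂ` and a monic `P ∈ ℂ[X]` (which splits), `arithFrobPolyOfSatake ι q 1 (P.roots.map (·⁻¹))
= ∏_{β} (X - ι⁻¹((β⁻¹)⁻¹)) = ∏_{β} (X - ι⁻¹ β) = P.map ι⁻¹` — the `m = 1` twin of the tree's
`arithFrobPolyOfSatake_heckeRoots` (`m = 2`); no non-vanishing of the roots is needed
(`(β⁻¹)⁻¹ = β` also for `β = 0`).  Buzzard–Gee's L-normalisation. [cite: BuzzardGeeLMS2014, §2.1] -/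
theorem arithFrobPolyOfSatake_one_rootsInv {p : ℕ} [Fact p.Prime] (ι : PadicAlgCl p ≃+* ℂ)
    (q : ℕ) {P : ℂ[X]} (hP : P.Monic) :
    arithFrobPolyOfSatake ι q 1 (P.roots.map (·⁻¹)) = P.map (ι.symm : ℂ →+* PadicAlgCl p) := by
  rw [arithFrobPolyOfSatake_one, Multiset.map_map]
  have hcard : Multiset.card P.roots = P.natDegree :=
    Polynomial.splits_iff_card_roots.mp (IsAlgClosed.splits P)
  trans (P.roots.map fun β ↦ (X - C β).map (ι.symm : ℂ →+* PadicAlgCl p)).prod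
  · congr 1
    refine Multiset.map_congr rfl fun β _ ↦ ?_
    simp only [Function.comp_apply, inv_inv, Polynomial.map_sub, Polynomial.map_X, Polynomial.map_C]
    rfl
  · conv_rhs => rw [← Polynomial.prod_multiset_X_sub_C_of_monic_of_roots_card_eq hP hcard]
    rw [Polynomial.map_multiset_prod, Multiset.map_map]
    rfl

/-- The finite places of `ℚ` whose prime divides `n ≠ 0` form a finite set (`v ↦ p_v` is injective,
`Rat.HeightOneSpectrum.primesEquiv`). [folklore] -/
theorem finite_setOf_primesEquiv_dvd {n : ℕ} (hn : n ≠ 0) :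
    {v : HeightOneSpectrum (𝓞 ℚ) | ((Rat.HeightOneSpectrum.primesEquiv v : Nat.Primes) : ℕ) ∣ n}.Finite := by
  refine ((Set.finite_Iic n).preimage
    (f := fun v : HeightOneSpectrum (𝓞 ℚ) ↦ ((Rat.HeightOneSpectrum.primesEquiv v : Nat.Primes) : ℕ))
    ?_).subset ?_
  · intro v _ v' _ hvv'
    exact Rat.HeightOneSpectrum.primesEquiv.injective (Subtype.ext hvv')
  · intro v hv
    exact Nat.le_of_dvd (Nat.pos_of_ne_zero hn) hv

/-- For `n ≠ 0`, almost every finite place `v` of `ℚ` has `p_v ∤ n`. [folklore] -/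
theorem eventually_not_dvd {n : ℕ} (hn : n ≠ 0) :
    ∀ᶠ v : HeightOneSpectrum (𝓞 ℚ) in Filter.cofinite,
      ¬ ((Rat.HeightOneSpectrum.primesEquiv v : Nat.Primes) : ℕ) ∣ n := by
  rw [Filter.eventually_cofinite]
  simpa only [not_not] using finite_setOf_primesEquiv_dvd hn

/-- A newform is non-zero (`a₁ = 1`), hence so is its adelic lift (`exists_adelicLiftFun_ne_zero`:
`|φ_f((y x; 0 1), 1)| = |f(x+iy)| y^{w/2}`). [cite: Gelbart1975, (3.4)] -/
theorem adelicLiftFunA_ne_zero_of_isNewform1 {M : ℕ} [NeZero M] {w : ℤ} {g : CuspForm (Gamma1 M) w}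
    (hg : IsNewform1 g) : adelicLiftFunA M w ⇑g ≠ 0 := by
  have hg0 : g ≠ 0 := by
    rintro rfl
    have h1 := hg.2.2.2
    unfold IsNormalized at h1
    rw [CuspForm.coe_zero, UpperHalfPlane.qExpansion_zero, map_zero] at h1
    exact zero_ne_one h1
  have hex : ∃ τ₀ : UpperHalfPlane, g τ₀ ≠ 0 := by
    by_contra h
    exact hg0 (DFunLike.ext g 0 fun τ₀ => by rw [not_exists.mp h τ₀ |> not_not.mp]; rfl)
  obtain ⟨x, -, hx⟩ := exists_adelicLiftFun_ne_zero (N := M) (k := w) g hex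
  intro h0
  apply hx
  have h1 : adelicLiftFunA M w ⇑g (Rat.ofRealGL 2 x) = 0 := by rw [h0]; rfl
  simpa using h1

/-! ## The crux from Khare–Wintenberger -/

/-- **`SerreKWAutomorphicGL2` from the Khare–Wintenberger fact** (`proof.conditional` on
`khare_wintenberger` ALONE; every other ingredient is a theorem of the tree, landed as the six stub
files of the line).  Fix `p, k, red, σ̄` odd irreducible, `hcpt₂`, `ι`.  Stub 1 (KW): a newform `f` of weight
`w ≥ 2`, level `N`, and `ι_f : 𝓞_f → k` with `charpoly σ̄(Frob_q) = ι_f(P_q)`, `P_q ↦ H_q(f)`, for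
`q ∤ Np`.  Stub 2: `τ : K_f → ℂ`, `θ : 𝓞_f → 𝒪_{ℚ̄_p}` with `θ = ι⁻¹τ` on `𝓞_f`, `red ∘ θ = ι_f`.
Stub 3: a newform `g` of weight `w`, level `M`, with `H_q(g) = τ(H_q(f))` in `ℂ[X]` for `q ∤ NM`.
Stubs 4, 5, 6, 7 applied to `g`: an L-algebraic cuspidal `π₂` on `GL₂(𝔸_ℚ)` with Satake multiset
`H_q(g).roots⁻¹` a.e.  At every `v` outside the three finite exceptional sets put
`P := θ(P_q) ∈ 𝒪_{ℚ̄_p}[X]`, `Pb := ι_f(P_q)`: then `P ↦ ι⁻¹τ(P_q ↦ K_f) = ι⁻¹(τ H_q(f)) = ι⁻¹ H_q(g)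
= arithFrobPolyOfSatake ι q 1 (H_q(g).roots⁻¹)` (`arithFrobPolyOfSatake_one_rootsInv`) and
`P mod 𝔪 = red(θ P_q) = ι_f(P_q) = Pb = charpoly σ̄(Frob_v)`, with `σ̄` unramified at `v`. -/
theorem SerreKWAutomorphicGL2_of_khareWintenberger
    (hKW : ∀ (p : ℕ) [Fact p.Prime] (k : Type) [Field k] [TopologicalSpace k] [DiscreteTopology k],
      khare_wintenberger p k) :
    Summit.Langlands.Langlands.Theses.PhantomRMYoshida.SerreKWAutomorphicGL2 := by
  intro p _ k _ _ _ _ _ red σ hodd hirr hcpt₂ ι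
  -- (A) Galois side: KW (the named fact, Stub 1, through its weak form), alignment, conjugation
  obtain ⟨N, _instN, w, hw, f, ιf, hf, hKW⟩ :=
    serreModularityTwoLe_of_khareWintenberger hKW p k σ hodd hirr
  obtain ⟨τ, θ, hθ, hred⟩ := stub_residueAdaptedEmbedding p k red ι N _ f hf ιf
  obtain ⟨M, _instM, g, hg, hconj⟩ := stub_conjugateNewform N _ f hf τ
  -- (B) automorphic side for the conjugate newform `g`
  have hw' : (2 : ℤ) ≤ ((w : ℕ) : ℤ) := by exact_mod_cast hw
  obtain ⟨hsm, hlow⟩ := stub_loweringKillsLift M _ g hcpt₂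
  have hφ : adelicLiftFunA M (w : ℤ) ⇑g ∈ cuspFormsGL 2 ℚ hcpt₂ :=
    (stub_adelicLiftIsCuspForm M _ hw' g hcpt₂ hsm hlow).mem_cuspFormsGL
  have hφ0 : adelicLiftFunA M (w : ℤ) ⇑g ≠ 0 := adelicLiftFunA_ne_zero_of_isNewform1 hg
  have harch := stub_archParameterOfGeneratedDatum M _ g hcpt₂ hlow hφ hφ0
  obtain ⟨π₂, hL, hsat₂⟩ :=
    stub_dictionaryL M _ hw' g hg hcpt₂ (CuspidalAutomorphicRepData.ofCuspForm hφ hφ0)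
      (CuspidalAutomorphicRepData.mem_W_ofCuspForm hφ hφ0)
      (CuspidalAutomorphicRepData.not_mem_W'_ofCuspForm hφ hφ0) harch
  refine ⟨π₂, hL, ?_⟩
  -- the three finite exceptional sets
  have hp : p.Prime := Fact.out
  have hgoodNp := eventually_not_dvd (n := N * p) (mul_ne_zero (NeZero.ne N) hp.ne_zero)
  have hgoodNM := eventually_not_dvd (n := N * M) (mul_ne_zero (NeZero.ne N) (NeZero.ne M))
  filter_upwards [hsat₂, hgoodNp, hgoodNM] with v hv hvNp hvNM
  -- KW's local clause at `v`
  obtain ⟨hunr, Pint, hPint, hFrob⟩ := hKW v hvNp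
  refine ⟨_, Pint.map θ, Pint.map ιf, hv, ?_, hunr, hFrob, ?_⟩
  · -- integrality transport + the root-form identity
    have hmonic : ((heckePolynomial g ((Rat.HeightOneSpectrum.primesEquiv v : Nat.Primes) : ℕ)).map
        (algebraMap (coeffCharField g) ℂ)).Monic :=
      (monic_heckePolynomial g _).map _
    have hθ' : (Valued.integer (PadicAlgCl p)).subtype.comp θ =
        ((ι.symm : ℂ →+* PadicAlgCl p).comp τ).comp
          (algebraMap (coeffCharIntegers f) (coeffCharField f)) :=
      RingHom.ext fun x => hθ x
    rw [arithFrobPolyOfSatake_one_rootsInv ι _ hmonic,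
      hconj _ (Rat.HeightOneSpectrum.primesEquiv v).2 hvNM]
    simp only [Polynomial.map_map]
    rw [← hPint, Polynomial.map_map, hθ']
  · rw [Polynomial.map_map]
    exact congrArg (fun F : coeffCharIntegers f →+* k => Pint.map F) (RingHom.ext hred)

end Summit.Langlands.Langlands.Cruxes.SerreKWAutomorphicGL2.AdelicNewformDatumDoubleTwist

end
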